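import Literature.MathematicalPhysics.QuantumFieldTheory.Balaban1983to89.B9CoReadingCoords
import Literature.MathematicalPhysics.QuantumFieldTheory.Balaban1983to89.B9RWSums343to347Whole
import Literature.MathematicalPhysics.QuantumFieldTheory.Balaban1983to89.B9Ineq349SiteComposite
import Literature.MathematicalPhysics.QuantumFieldTheory.Balaban1983to89.B9Ineq347GpAtLetters

/-!
# `Balaban1983to89.B9CoReadingCoordsS` — the κ-FOLD REAL-COORDINATE MODEL of a SITE-sector letter (G′(U)): the repaired (3.42) co-readings
# `CoRealizesRel … (RelB i) …` and the (3.47) readings `GlobReads` of def-Y's `kernelFamilyS` HOLD AT EVERY `U`, FOR EVERY LETTER, no domination hypothesis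

T. Bałaban, *Propagators for lattice gauge theories in a background field*, Commun. Math. Phys. **99** (1985) 389–434
[`Balaban1985BackgroundPropagators`, "B9"]; [4] = T. Bałaban, *Propagators and renormalization transformations for lattice gauge
theories. II*, Commun. Math. Phys. **96** (1984) 223–250 [`Balaban1984PropagatorsII`].

statement-level skeleton of published theorems with citation tags; proofs where landed; nothing here is a claim about the
Yang–Mills mass gap

THE PRINTED LOCI.  [B9] Thm 3.1 (3.42) p. 397 *"|(G′(U)λ)(x)|, |(∇_U G′(U)λ)(x)|, |(G′(U)∇*_U λ)(x)|, |(Δ_U G′(U)λ)(x)| ≦ B₀[(Lʲη)², Lʲη, Lʲη, 1]e^{−δ₀d(y,y′)}|λ|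
for x ∈ Δ(y), y ∈ Λ_j, supp λ ⊂ Δ(y′)"*; (3.41) p. 397 (the weighted norm `|λ|_{(α)}`); (3.47) p. 398 (the global inequalities with the weights
`[(Lʲη)², Lʲη, Lʲη, 1]·(Lʲη)^γ`); [4] (2.51)–(2.52) p. 232 (block majorants), (2.67) p. 234 (the prefactors `η^{(2,1,1,0)}` of the site sector).

WHY THIS FILE (sequel of `B9CoReadingCoords` ∕ `B9CoReadingCoordsGlob`, seat n06-d g4).  The N06 knit reads the (3.42)∕(3.47) entries of the SITE-sector letter
`O : SiteOpY 𝔸 i` (def-Y's G′(U)) through `Node00.kernelFamilyS` — `η^{(2,1,1,0)}`-weighted sups over the unit ball of `𝔸` of block sups of `‖(O(U)(f ⊗ E))(z)‖` and its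
covariant differences — and row 18's leaves (n06-k `rows131819_definite_geo9Y_rel`) relate them to REAL MODEL operators by the co-readings `CoRealizesRel`
(repaired, relative to the carrier-block equivalence `RelB i`) and `GlobReads`.  This file makes those co-readings THEOREMS on the κ-fold coordinate model:
* §1 (generic finite set `S`, direction set `D`): the pointwise domination of the reading by the scaled coordinate model, `‖(T ν (J ⊗ E))(x)‖ ≤ g` from
  `|(cR39 • coordOpK T)(evDiagK J)(x, ν, c, c′)| ≤ g` (`norm_le_of_coordModelK_le_at`), and its `r`-scaled form `r·‖…‖ ≤ g` from `|((r·cR39) • coordOpK T) …| ≤ g`.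
* §2 (at an index `i`, site sector): the carrier `XSK κ i := SiteY i × Fin (d+1) × κ × κ`, the evaluation `evSK` (`.inl f ↦ evDiagK f`, `.inr ↦ 0`), the block map
  `blkSK sI := sI ∘ fst` through a block map `sI : SiteY i → IBondY i` CARRIER-FAITHFUL on sites (`β (sI z) = Δ(z)` whenever `Δ(z)` is a carrier block) and
  LEVEL-FAITHFUL (`lvl (sI z) = j(z)`) — both inherited from a faithful bond-level map `bI` through `sIK bI z := bI ⟨z, e₀⟩` (`sIK_faithful`, `sIK_level`); the
  ℝ-linear covariant Laplacian `lapSₗ` (n06-i's `cdSL ∕ cdsSL` restricted to ℝ); and the MODEL LETTERS with print's prefactors folded in: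
  ★ `GcoS := (η²·cR39) • coordOpK (O(U))`, `DcoS := η⁻¹ • coordOpK (∇_U)`, `DscoS := η⁻¹ • coordOpK (∇*_U)`, `LcoS := η⁻² • coordOpK (Δ_U)`, whose composites ARE
  `(η·cR39) • coordOpK (∇_U O)`, `(η·cR39) • coordOpK (O ∇*_U)`, `cR39 • coordOpK (Δ_U O)` (`DcoS_comp_GcoS`, `GcoS_comp_DscoS`, `LcoS_comp_GcoS`).
* §3 ★★ `coRealizesRel_kernelFamilyS_coords n` and ★★ `globReads_kernelFamilyS_coords n` (n = 0, 1, 2, 3): for EVERY site-sector letter `O`, every backgrounds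
  record, transporters, `U₁`, real basis `b` and faithful `sI` — exactly the eight shapes of row 18's binders `hco0‥3 ∕ hgl0‥3`.
HONEST SCOPE.  Finite-dimensional linear algebra over def-Y's readings; the L² (3.46), Hölder (3.43)–(3.45) and input species are NOT treated; nothing of [B9] or
[4] is asserted; COUNT-NEUTRAL; N06 NOT discharged; one finite 𝕋⁴ programme at fixed ε — nothing continuum, nothing about the mass gap.  Cell `pub-ymgap`
(HUMAN RULING D-0062), Track A node N06 [B9], seat `pub-ymgap-dag-n06-d` (g4), 2026-08-27.
-/

noncomputable section

namespace Literature.MathematicalPhysics.QuantumFieldTheory.Balaban1983to89.B9CoReadingCoordsS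

open B6SectAOperatorsV1 (BondIdx)
open B6GlobalChartV1 (PV domT blkV1 boxEquiv toBox)
open B6ScalarChartV1 (toBox_boxEquiv_symm)
open B6Geom246MultiLevelBox (bset blkOf)
open B6Ineq2142KLevelV1 (β lvl)
open B6KLevelCensusIndexV1 (KIdx)
open B6Prop22KLevelCensusEta (epow)
open B9GeoNormsKLevelV1 (geo9K wNormS geo9K_wNorm_nonneg geo9K_supNorm_nonneg)
open B9CoRealizesRel (CoRealizesRel)
open B9CoRealizesRelAtLetters (RelB)
open B9RWSums343to347Whole (GlobReads)
open B9Ineq347GpAtLetters (wNormSY_le_of_pointwise abs_le_wNormS_mul_scale)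
open B9Ineq349SiteComposite (cdSL cdsSL cdSL_apply cdsSL_apply supBlkS_le supBlkS'_le etaS_pos)
open B9Thm39ReadingCoords (cR39 cR39_nonneg)
open B9CoReadingCoords (evDiagK abs_evDiagK_le evDiagK_eq_zero_of coordOpK coordOpK_comp coordOpK_evDiagK norm_apply_liftY_le)
open Node00 (SiteY FBondY BlkY IBondY CfgY BallY liftY KLoc etaS supBlkS supBlkS' wNormSY kernelFamilyS eLatS SiteOpY SiteParY cdS cdsS lapS iSup_ball_le)

variable {d ℓ : ℕ} {hd : 1 ≤ d + 1} {hL : Odd (ℓ + 1) ∧ 1 < ℓ + 1} {b₀ b₁ : ℝ}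
variable {𝔸 : Type} [NormedRing 𝔸] [NormedAlgebra ℂ 𝔸]
variable {κ : Type} [Fintype κ] [DecidableEq κ]

/-! ## §1 The pointwise domination of the reading by the (scaled) coordinate model, over any finite point set -/

section Pointwise

variable {S D : Type} (b : Module.Basis κ ℝ 𝔸) [FiniteDimensional ℝ 𝔸]

/-- ★ **THE POINTWISE CORE over any point set**: if the `cR39`-scaled coordinate model of a family `T` at the diagonal evaluation of `J` is `≤ g` in absolute
value at every coordinate point over `x`, then `‖(T ν (J ⊗ E))(x)‖ ≤ g` for `‖E‖ ≤ 1` and every direction slot `ν`.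
[cite: Balaban1985BackgroundPropagators, (3.39) + (3.41) p.397; Balaban1984PropagatorsII, (2.51) p.232] -/
theorem norm_le_of_coordModelK_le_at (T : D → (S → 𝔸) →ₗ[ℝ] (S → 𝔸)) (J : S → ℝ) (x : S) {g : ℝ} (hg : 0 ≤ g)
    (h : ∀ (ν : D) (c c' : κ), |(cR39 b • coordOpK b T) (evDiagK J) (x, ν, c, c')| ≤ g) {E : 𝔸} (hE : ‖E‖ ≤ 1) (ν : D) :
    ‖T ν (liftY J E) x‖ ≤ g := by
  have hcoord : ∀ cc cc' : κ, cR39 b * |b.repr (T ν (liftY J (b cc')) x) cc| ≤ g := by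
    intro cc cc'
    have := h ν cc cc'
    rwa [LinearMap.smul_apply, Pi.smul_apply, coordOpK_evDiagK, smul_eq_mul, abs_mul, abs_of_nonneg (cR39_nonneg b)] at this
  rcases isEmpty_or_nonempty κ with hκ | hκ
  · have hA : ∀ v : 𝔸, v = 0 := fun v => by
      rw [← b.sum_repr v]; exact Finset.sum_eq_zero fun c _ => (hκ.false c).elim
    rw [hA (T ν (liftY J E) x), norm_zero]; exact hg
  · obtain ⟨q, -, hq⟩ := Finset.exists_max_image (Finset.univ : Finset (κ × κ)) (fun q => |b.repr (T ν (liftY J (b q.2)) x) q.1|)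
      Finset.univ_nonempty
    have hM : ∀ cc cc' : κ, |b.repr (T ν (liftY J (b cc')) x) cc| ≤ |b.repr (T ν (liftY J (b q.2)) x) q.1| :=
      fun cc cc' => hq (cc, cc') (Finset.mem_univ _)
    exact (norm_apply_liftY_le b (T ν) J hE x hM).trans (hcoord q.1 q.2)

/-- ★ **the `r`-SCALED pointwise core** (`r > 0`, print's prefactors `η², η` folded into the model): `|((r·cR39) • coordOpK T)(evDiagK J)(x, ν, c, c′)| ≤ g` at every
coordinate point over `x` gives `r·‖(T ν (J ⊗ E))(x)‖ ≤ g`. [cite: Balaban1985BackgroundPropagators, (3.42) p.397; Balaban1984PropagatorsII, (2.67) p.234 (prefactors)] -/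
theorem mul_norm_le_of_coordModelK_le_at (T : D → (S → 𝔸) →ₗ[ℝ] (S → 𝔸)) (J : S → ℝ) (x : S) {g : ℝ} (hg : 0 ≤ g) {r : ℝ} (hr : 0 < r)
    (h : ∀ (ν : D) (c c' : κ), |((r * cR39 b) • coordOpK b T) (evDiagK J) (x, ν, c, c')| ≤ g) {E : 𝔸} (hE : ‖E‖ ≤ 1) (ν : D) :
    r * ‖T ν (liftY J E) x‖ ≤ g := by
  have h' : ∀ (ν : D) (c c' : κ), |(cR39 b • coordOpK b T) (evDiagK J) (x, ν, c, c')| ≤ g / r := by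
    intro ν c c'
    have := h ν c c'
    rw [LinearMap.smul_apply, Pi.smul_apply, smul_eq_mul, mul_assoc, abs_mul, abs_of_pos hr] at this
    rw [LinearMap.smul_apply, Pi.smul_apply, smul_eq_mul, le_div_iff₀' hr]
    exact this
  exact (le_div_iff₀' hr).1 (norm_le_of_coordModelK_le_at b T J x (div_nonneg hg hr.le) h' hE ν)

end Pointwise

/-! ## §2 At an index: the site-sector carrier, the faithful block map, the ℝ-linear Laplacian, the model letters -/

section Site

variable [CompleteSpace 𝔸] (i : KIdx d ℓ hd hL b₀ b₁)

variable (κ) in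
/-- **the κ-fold coordinate carrier of the site sector** at an index: box-chart site × direction slot × output coordinate × lift direction.
[cite: Balaban1985BackgroundPropagators, (3.41) + (3.42) p.397, dictionary] -/
abbrev XSK : Type := SiteY i × Fin (d + 1) × κ × κ

/-- the evaluation of the sum-typed arguments of `geo9K i` on the site carrier: `.inl f ↦ evDiagK f`, `.inr J ↦ 0` (the site-sector readings are OFF on bond arguments).
[cite: Balaban1985BackgroundPropagators, (3.42) p.397 («λ»), dictionary] -/
def evSK : (geo9K i).Loc → XSK κ i → ℝ := fun lam p => match lam with
  | .inl f => evDiagK f p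
  | .inr _ => 0

/-- the block map of the site carrier through a block map `sI` on sites. [cite: Balaban1984PropagatorsII, (2.45) p.231, dictionary] -/
def blkSK (sI : SiteY i → IBondY i) : XSK κ i → IBondY i := fun p => sI p.1

/-- the block map on SITES induced by a block map on fine bonds: `z ↦ bI ⟨z, e₀⟩` (the fine bond leaving the torus site charted to `z` in direction 0).
[cite: Balaban1984PropagatorsII, (2.45) p.231 + p.248 («sites replaced by bonds»), dictionary] -/
def sIK (bI : FBondY i → IBondY i) : SiteY i → IBondY i := fun z => bI ⟨(boxEquiv i.hN).symm z, 0⟩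

/-- the fine bond `⟨z, e₀⟩` lies in the block of `z`. [cite: Balaban1984PropagatorsII, (2.45) p.231, bookkeeping] -/
theorem blkV1_site (z : SiteY i) : blkV1 i.hN i.D (⟨(boxEquiv i.hN).symm z, 0⟩ : FBondY i) = blkOf i.D.toDomains z := by
  show blkOf i.D.toDomains (toBox i.hN ((boxEquiv i.hN).symm z)) = _
  rw [toBox_boxEquiv_symm]

/-- **carrier-faithfulness on sites from carrier-faithfulness on bonds**: if `Δ(z)` is the carrier block of `c`, then `β (sIK bI z) = Δ(z)`.
[cite: Balaban1984PropagatorsII, (2.45) p.231, bookkeeping] -/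
theorem sIK_faithful {bI : FBondY i → IBondY i}
    (hβI : ∀ (x : FBondY i) (c : IBondY i), blkV1 i.hN i.D x = β i.hN i.D i.hk c → β i.hN i.D i.hk (bI x) = blkV1 i.hN i.D x)
    (z : SiteY i) (c : IBondY i) (hz : blkOf i.D.toDomains z = β i.hN i.D i.hk c) : β i.hN i.D i.hk (sIK i bI z) = blkOf i.D.toDomains z := by
  have hx := blkV1_site i z
  exact (hβI _ c (hx.trans hz)).trans hx

/-- **level-faithfulness on sites from level-faithfulness on bonds**: `lvl (sIK bI z) = j(z)`. [cite: Balaban1985BackgroundPropagators, (3.41) p.397, bookkeeping] -/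
theorem sIK_level {bI : FBondY i → IBondY i} (hlev : ∀ x : FBondY i, lvl i.hN i.D i.hk (bI x) = (blkV1 i.hN i.D x).1.1) (z : SiteY i) :
    lvl i.hN i.D i.hk (sIK i bI z) = (blkOf i.D.toDomains z).1.1 := by
  rw [sIK, hlev, blkV1_site]

/-- n06-i's `cdSL ∕ cdsSL` assembled: the covariant Laplacian `Σ_μ ∇*_{U,μ}∇_{U,μ}` on the site sector as an ℝ-linear map.
[cite: Balaban1985BackgroundPropagators, (3.23) p.395] -/
def lapSₗ (U : CfgY 𝔸 i) : (SiteY i → 𝔸) →ₗ[ℝ] (SiteY i → 𝔸) :=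
  ∑ μ : Fin (d + 1), (cdsSL i U μ).restrictScalars ℝ ∘ₗ (cdSL i U μ).restrictScalars ℝ

/-- `lapSₗ` IS def-Y's `lapS`. [cite: Balaban1985BackgroundPropagators, (3.23) p.395, bookkeeping] -/
theorem lapSₗ_apply (U : CfgY 𝔸 i) (Φ : SiteY i → 𝔸) : lapSₗ i U Φ = lapS i U Φ := by
  funext z
  simp only [lapSₗ, LinearMap.coe_sum, Finset.sum_apply, LinearMap.comp_apply, LinearMap.coe_restrictScalars, cdSL_apply, cdsSL_apply, lapS]

/-- the scale length of the site `z` in the units of the record: `L^{j(z)}|c_f|⁻¹`. [cite: Balaban1985BackgroundPropagators, (3.41) p.397, dictionary] -/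
def lenSZ (z : SiteY i) : ℝ := ((ℓ : ℝ) + 1) ^ (i.D.lev z.1) * |i.cf|⁻¹

/-- `0 < L^{j(z)}|c_f|⁻¹`. [cite: Balaban1985BackgroundPropagators, (3.41) p.397, bookkeeping] -/
theorem lenSZ_pos (z : SiteY i) : 0 < lenSZ i z := mul_pos (pow_pos (by positivity) _) (inv_pos.2 (abs_pos.2 i.hcf))

omit [Fintype κ] [DecidableEq κ] in
/-- the scale length of the index bond `sI z` IS `L^{j(z)}|c_f|⁻¹` for a LEVEL-FAITHFUL `sI`. [cite: Balaban1985BackgroundPropagators, (3.41) p.397, bookkeeping] -/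
theorem len_blkSK_eq {sI : SiteY i → IBondY i} (hlevS : ∀ z : SiteY i, lvl i.hN i.D i.hk (sI z) = (blkOf i.D.toDomains z).1.1) (p : XSK κ i) :
    (geo9K i).len (blkSK (κ := κ) i sI p) = lenSZ i p.1 := by
  show (((ℓ + 1 : ℕ) : ℝ)) ^ (lvl i.hN i.D i.hk (sI p.1)) * |i.cf|⁻¹ = _
  rw [hlevS p.1, lenSZ]
  push_cast
  rfl

variable (b : Module.Basis κ ℝ 𝔸) [FiniteDimensional ℝ 𝔸] (B : B9.Backgrounds) (cfg : B.Cfg → CfgY 𝔸 i) (O : SiteOpY 𝔸 i)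

/-- ★ **THE MODEL LETTER OF A SITE-SECTOR `O` AT `U₁`**: `(η²·cR39 b) • coordOpK b (fun _ => O(cfg U₁))` — the genuine operator in κ-fold real coordinates, carrying
print's prefactor `η²` of the first (3.42) entry. [cite: Balaban1985BackgroundPropagators, (3.42) p.397 («G′(U)»); Balaban1984PropagatorsII, (2.67) p.234 (η²)] -/
def GcoS (U₁ : B.Cfg) : (XSK κ i → ℝ) →ₗ[ℝ] (XSK κ i → ℝ) :=
  (etaS i ^ 2 * cR39 b) • coordOpK b (fun _ : Fin (d + 1) => (O (cfg U₁)).restrictScalars ℝ)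

/-- the model of `∇_U` on the site sector, prefactor `η⁻¹`. [cite: Balaban1985BackgroundPropagators, (3.42) p.397 («∇_U G′(U)»)] -/
def DcoS (U₁ : B.Cfg) : (XSK κ i → ℝ) →ₗ[ℝ] (XSK κ i → ℝ) := (etaS i)⁻¹ • coordOpK b (fun ν => (cdSL i (cfg U₁) ν).restrictScalars ℝ)

/-- the model of `∇*_U` on the site sector, prefactor `η⁻¹`. [cite: Balaban1985BackgroundPropagators, (3.42) p.397 («G′(U)∇*_U»)] -/
def DscoS (U₁ : B.Cfg) : (XSK κ i → ℝ) →ₗ[ℝ] (XSK κ i → ℝ) := (etaS i)⁻¹ • coordOpK b (fun ν => (cdsSL i (cfg U₁) ν).restrictScalars ℝ)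

/-- the model of `Δ_U` on the site sector, prefactor `η⁻²`. [cite: Balaban1985BackgroundPropagators, (3.42) p.397 («Δ_U G′(U)»)] -/
def LcoS (U₁ : B.Cfg) : (XSK κ i → ℝ) →ₗ[ℝ] (XSK κ i → ℝ) := (etaS i ^ 2)⁻¹ • coordOpK b (fun _ : Fin (d + 1) => lapSₗ i (cfg U₁))

omit [DecidableEq κ] in
/-- the entry-1 composite IS the `(η·cR39)`-scaled coordinate model of `ν ↦ ∇_{U,ν} ∘ O(U)`. [cite: Balaban1985BackgroundPropagators, (3.42) p.397, bookkeeping] -/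
theorem DcoS_comp_GcoS (U₁ : B.Cfg) : DcoS i b B cfg U₁ ∘ₗ GcoS i b B cfg O U₁ =
    (etaS i * cR39 b) • coordOpK b (fun ν => (cdSL i (cfg U₁) ν).restrictScalars ℝ ∘ₗ (O (cfg U₁)).restrictScalars ℝ) := by
  have hs : (etaS i)⁻¹ * (etaS i ^ 2 * cR39 b) = etaS i * cR39 b := by rw [pow_two, mul_assoc, inv_mul_cancel_left₀ (etaS_pos i).ne']
  rw [DcoS, GcoS, LinearMap.smul_comp, LinearMap.comp_smul, coordOpK_comp, smul_smul, hs]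

omit [DecidableEq κ] in
/-- the entry-2 composite IS the `(η·cR39)`-scaled coordinate model of `ν ↦ O(U) ∘ ∇*_{U,ν}`. [cite: Balaban1985BackgroundPropagators, (3.42) p.397, bookkeeping] -/
theorem GcoS_comp_DscoS (U₁ : B.Cfg) : GcoS i b B cfg O U₁ ∘ₗ DscoS i b B cfg U₁ =
    (etaS i * cR39 b) • coordOpK b (fun ν => (O (cfg U₁)).restrictScalars ℝ ∘ₗ (cdsSL i (cfg U₁) ν).restrictScalars ℝ) := by
  have hs : etaS i ^ 2 * cR39 b * (etaS i)⁻¹ = etaS i * cR39 b := by rw [mul_right_comm, pow_two, mul_inv_cancel_right₀ (etaS_pos i).ne']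
  rw [GcoS, DscoS, LinearMap.smul_comp, LinearMap.comp_smul, coordOpK_comp, smul_smul, hs]

omit [DecidableEq κ] in
/-- the entry-3 composite IS the `cR39`-scaled coordinate model of `Δ_U ∘ O(U)` (prefactor `η⁰`). [cite: Balaban1985BackgroundPropagators, (3.42) p.397, bookkeeping] -/
theorem LcoS_comp_GcoS (U₁ : B.Cfg) : LcoS i b B cfg U₁ ∘ₗ GcoS i b B cfg O U₁ =
    cR39 b • coordOpK b (fun _ : Fin (d + 1) => lapSₗ i (cfg U₁) ∘ₗ (O (cfg U₁)).restrictScalars ℝ) := by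
  have hs : (etaS i ^ 2)⁻¹ * (etaS i ^ 2 * cR39 b) = cR39 b := inv_mul_cancel_left₀ (pow_ne_zero 2 (etaS_pos i).ne') _
  rw [LcoS, GcoS, LinearMap.smul_comp, LinearMap.comp_smul, coordOpK_comp, smul_smul, hs]

end Site

/-! ## §3 ★★ The repaired (3.42) co-readings and the (3.47) readings of `kernelFamilyS` HOLD on the coordinate model — every letter, every `U` -/

section CoReading

variable [CompleteSpace 𝔸] [FiniteDimensional ℝ 𝔸] (i : KIdx d ℓ hd hL b₀ b₁) (b : Module.Basis κ ℝ 𝔸)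
variable (B : B9.Backgrounds) (cfg : B.Cfg → CfgY 𝔸 i) (O : SiteOpY 𝔸 i) (par : SiteParY 𝔸 i) (U₁ : B.Cfg)
variable {sI : SiteY i → IBondY i}

omit [Fintype κ] [FiniteDimensional ℝ 𝔸] in
/-- `off` and `bound` of the site coordinate model, for a block map `sI` carrier-faithful on sites. [cite: Balaban1985BackgroundPropagators, (3.42) p.397 («supp λ ⊂ Δ(y′)», «|λ|»), bookkeeping] -/
theorem off_bound_evSK (hσI : ∀ (z : SiteY i) (c : IBondY i), blkOf i.D.toDomains z = β i.hN i.D i.hk c → β i.hN i.D i.hk (sI z) = blkOf i.D.toDomains z) :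
    (∀ (lam : (geo9K i).Loc) (y' : (geo9K i).Site), (geo9K i).suppIn lam y' → ∀ p : XSK κ i, ¬ RelB i (blkSK i sI p) y' → evSK i lam p = 0) ∧
    (∀ (lam : (geo9K i).Loc) (p : XSK κ i), |evSK i lam p| ≤ (geo9K i).supNorm lam) := by
  refine ⟨?_, ?_⟩
  · intro lam y' hs p hrel
    cases lam with
    | inr J => rfl
    | inl f =>
        refine evDiagK_eq_zero_of ?_
        by_contra hf
        have hz : blkOf i.D.toDomains p.1 = β i.hN i.D i.hk y' := hs p.1 hf
        exact hrel ((hσI p.1 y' hz).trans hz)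
  · intro lam p
    cases lam with
    | inr J => show |(0 : ℝ)| ≤ _; rw [abs_zero]; exact geo9K_supNorm_nonneg i _
    | inl f => exact (abs_evDiagK_le f p).trans (le_ciSup (f := fun x => |f x|) (Set.finite_range _).bddAbove p.1)

/-- ★★ **ENTRY 0 — `CoRealizesRel (kernelFamilyS i B cfg O par) 0 U₁ (RelB i) (blkSK sI) (blkSK sI) evSK (GcoS …)`** for EVERY site-sector letter `O` and EVERY `U₁`:
`η²·sup_{z ∈ Δ(y)} ‖(O(U)(f ⊗ E))(z)‖` is dominated through the `η²`-scaled coordinate model. [cite: Balaban1985BackgroundPropagators, (3.42) p.397 (first entry); Balaban1984PropagatorsII, (2.51) p.232, (2.67) p.234] -/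
theorem coRealizesRel_kernelFamilyS_coords_zero
    (hσI : ∀ (z : SiteY i) (c : IBondY i), blkOf i.D.toDomains z = β i.hN i.D i.hk c → β i.hN i.D i.hk (sI z) = blkOf i.D.toDomains z) :
    CoRealizesRel (kernelFamilyS i B cfg O par) 0 U₁ (RelB i) (blkSK i sI) (blkSK i sI) (evSK i) (GcoS i b B cfg O U₁) := by
  obtain ⟨hoff, hbd⟩ := off_bound_evSK (κ := κ) i hσI
  refine ⟨hoff, hbd, fun lam => geo9K_supNorm_nonneg i lam, ?_⟩
  intro lam y c hc hx
  cases lam with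
  | inr J => exact hc
  | inl f =>
      have hη : 0 < etaS i ^ 2 := pow_pos (etaS_pos i) 2
      have h0 : epow 0 = 2 := rfl
      show etaS i ^ (epow 0) * (⨆ E : BallY 𝔸, eLatS i O (cfg U₁) (liftY f (E : 𝔸)) (β i.hN i.D i.hk y) 0) ≤ c
      rw [h0, mul_comm, ← le_div_iff₀ hη]
      refine iSup_ball_le (fun E => ?_) (div_nonneg hc hη.le)
      show supBlkS i (β i.hN i.D i.hk y) (O (cfg U₁) (liftY f (E : 𝔸))) ≤ c / etaS i ^ 2
      refine supBlkS_le i (β i.hN i.D i.hk y) (O (cfg U₁) (liftY f (E : 𝔸))) (div_nonneg hc hη.le) fun z hz => ?_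
      rw [le_div_iff₀ hη, mul_comm]
      exact mul_norm_le_of_coordModelK_le_at b (fun _ : Fin (d + 1) => (O (cfg U₁)).restrictScalars ℝ) f z hc hη
        (fun ν cc cc' => hx (z, ν, cc, cc') ((hσI z y hz).trans hz)) (mem_closedBall_zero_iff.1 E.2) 0

/-- ★★ **ENTRY 1 — `CoRealizesRel … 1 U₁ (RelB i) (blkSK sI) (blkSK sI) evSK (DcoS ∘ₗ GcoS)`**: `η·sup ‖(∇_U O(U)(f ⊗ E))(z)‖` through the composite model.
[cite: Balaban1985BackgroundPropagators, (3.42) p.397 (second entry); Balaban1984PropagatorsII, (2.51) p.232, (2.67) p.234] -/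
theorem coRealizesRel_kernelFamilyS_coords_one
    (hσI : ∀ (z : SiteY i) (c : IBondY i), blkOf i.D.toDomains z = β i.hN i.D i.hk c → β i.hN i.D i.hk (sI z) = blkOf i.D.toDomains z) :
    CoRealizesRel (kernelFamilyS i B cfg O par) 1 U₁ (RelB i) (blkSK i sI) (blkSK i sI) (evSK i) (DcoS i b B cfg U₁ ∘ₗ GcoS i b B cfg O U₁) := by
  obtain ⟨hoff, hbd⟩ := off_bound_evSK (κ := κ) i hσI
  refine ⟨hoff, hbd, fun lam => geo9K_supNorm_nonneg i lam, ?_⟩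
  intro lam y c hc hx
  cases lam with
  | inr J => exact hc
  | inl f =>
      have hη : 0 < etaS i := etaS_pos i
      have h1 : epow 1 = 1 := rfl
      rw [DcoS_comp_GcoS] at hx
      show etaS i ^ (epow 1) * (⨆ E : BallY 𝔸, eLatS i O (cfg U₁) (liftY f (E : 𝔸)) (β i.hN i.D i.hk y) 1) ≤ c
      rw [h1, pow_one, mul_comm, ← le_div_iff₀ hη]
      refine iSup_ball_le (fun E => ?_) (div_nonneg hc hη.le)
      show supBlkS' i (β i.hN i.D i.hk y) (fun μ => cdS i (cfg U₁) μ (O (cfg U₁) (liftY f (E : 𝔸)))) ≤ c / etaS i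
      refine supBlkS'_le i (β i.hN i.D i.hk y) (fun μ => cdS i (cfg U₁) μ (O (cfg U₁) (liftY f (E : 𝔸)))) (div_nonneg hc hη.le) fun z μ hz => ?_
      rw [le_div_iff₀ hη, mul_comm]
      exact mul_norm_le_of_coordModelK_le_at b (fun ν => (cdSL i (cfg U₁) ν).restrictScalars ℝ ∘ₗ (O (cfg U₁)).restrictScalars ℝ) f z hc hη
        (fun ν cc cc' => hx (z, ν, cc, cc') ((hσI z y hz).trans hz)) (mem_closedBall_zero_iff.1 E.2) μ

/-- ★★ **ENTRY 2 — `CoRealizesRel … 2 U₁ (RelB i) (blkSK sI) (blkSK sI) evSK (GcoS ∘ₗ DscoS)`**: `η·sup ‖(O(U)∇*_U (f ⊗ E))(z)‖`.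
[cite: Balaban1985BackgroundPropagators, (3.42) p.397 (third entry); Balaban1984PropagatorsII, (2.51) p.232, (2.67) p.234] -/
theorem coRealizesRel_kernelFamilyS_coords_two
    (hσI : ∀ (z : SiteY i) (c : IBondY i), blkOf i.D.toDomains z = β i.hN i.D i.hk c → β i.hN i.D i.hk (sI z) = blkOf i.D.toDomains z) :
    CoRealizesRel (kernelFamilyS i B cfg O par) 2 U₁ (RelB i) (blkSK i sI) (blkSK i sI) (evSK i) (GcoS i b B cfg O U₁ ∘ₗ DscoS i b B cfg U₁) := by
  obtain ⟨hoff, hbd⟩ := off_bound_evSK (κ := κ) i hσI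
  refine ⟨hoff, hbd, fun lam => geo9K_supNorm_nonneg i lam, ?_⟩
  intro lam y c hc hx
  cases lam with
  | inr J => exact hc
  | inl f =>
      have hη : 0 < etaS i := etaS_pos i
      have h2 : epow 2 = 1 := rfl
      rw [GcoS_comp_DscoS] at hx
      show etaS i ^ (epow 2) * (⨆ E : BallY 𝔸, eLatS i O (cfg U₁) (liftY f (E : 𝔸)) (β i.hN i.D i.hk y) 2) ≤ c
      rw [h2, pow_one, mul_comm, ← le_div_iff₀ hη]
      refine iSup_ball_le (fun E => ?_) (div_nonneg hc hη.le)
      show supBlkS' i (β i.hN i.D i.hk y) (fun μ => O (cfg U₁) (cdsS i (cfg U₁) μ (liftY f (E : 𝔸)))) ≤ c / etaS i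
      refine supBlkS'_le i (β i.hN i.D i.hk y) (fun μ => O (cfg U₁) (cdsS i (cfg U₁) μ (liftY f (E : 𝔸)))) (div_nonneg hc hη.le) fun z μ hz => ?_
      rw [le_div_iff₀ hη, mul_comm]
      exact mul_norm_le_of_coordModelK_le_at b (fun ν => (O (cfg U₁)).restrictScalars ℝ ∘ₗ (cdsSL i (cfg U₁) ν).restrictScalars ℝ) f z hc hη
        (fun ν cc cc' => hx (z, ν, cc, cc') ((hσI z y hz).trans hz)) (mem_closedBall_zero_iff.1 E.2) μ

/-- ★★ **ENTRY 3 — `CoRealizesRel … 3 U₁ (RelB i) (blkSK sI) (blkSK sI) evSK (LcoS ∘ₗ GcoS)`**: `sup ‖(Δ_U O(U)(f ⊗ E))(z)‖` (prefactor `η⁰`).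
[cite: Balaban1985BackgroundPropagators, (3.42) p.397 (fourth entry); Balaban1984PropagatorsII, (2.51) p.232, (2.67) p.234] -/
theorem coRealizesRel_kernelFamilyS_coords_three
    (hσI : ∀ (z : SiteY i) (c : IBondY i), blkOf i.D.toDomains z = β i.hN i.D i.hk c → β i.hN i.D i.hk (sI z) = blkOf i.D.toDomains z) :
    CoRealizesRel (kernelFamilyS i B cfg O par) 3 U₁ (RelB i) (blkSK i sI) (blkSK i sI) (evSK i) (LcoS i b B cfg U₁ ∘ₗ GcoS i b B cfg O U₁) := by
  obtain ⟨hoff, hbd⟩ := off_bound_evSK (κ := κ) i hσI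
  refine ⟨hoff, hbd, fun lam => geo9K_supNorm_nonneg i lam, ?_⟩
  intro lam y c hc hx
  cases lam with
  | inr J => exact hc
  | inl f =>
      have h3 : epow 3 = 0 := rfl
      rw [LcoS_comp_GcoS] at hx
      show etaS i ^ (epow 3) * (⨆ E : BallY 𝔸, eLatS i O (cfg U₁) (liftY f (E : 𝔸)) (β i.hN i.D i.hk y) 3) ≤ c
      rw [h3, pow_zero, one_mul]
      refine iSup_ball_le (fun E => ?_) hc
      show supBlkS i (β i.hN i.D i.hk y) (lapS i (cfg U₁) (O (cfg U₁) (liftY f (E : 𝔸)))) ≤ c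
      refine supBlkS_le i (β i.hN i.D i.hk y) (lapS i (cfg U₁) (O (cfg U₁) (liftY f (E : 𝔸)))) hc fun z hz => ?_
      have h : ‖(lapSₗ i (cfg U₁) ∘ₗ (O (cfg U₁)).restrictScalars ℝ) (liftY f (E : 𝔸)) z‖ ≤ c := norm_le_of_coordModelK_le_at b (fun _ : Fin (d + 1) => lapSₗ i (cfg U₁) ∘ₗ (O (cfg U₁)).restrictScalars ℝ) f z hc
        (fun ν cc cc' => hx (z, ν, cc, cc') ((hσI z y hz).trans hz)) (mem_closedBall_zero_iff.1 E.2) 0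
      rw [LinearMap.comp_apply, lapSₗ_apply] at h
      exact h

omit [FiniteDimensional ℝ 𝔸] [Fintype κ] in
/-- **the (3.41) domination of the diagonal evaluation on sites**: `|evSK lam p| ≤ (Lʲη)(sI p.1)^γ · |lam|_{(γ)}` for a LEVEL-FAITHFUL `sI`.
[cite: Balaban1985BackgroundPropagators, (3.41) p.397] -/
theorem evSK_wbound (hlevS : ∀ z : SiteY i, lvl i.hN i.D i.hk (sI z) = (blkOf i.D.toDomains z).1.1) (lam : (geo9K i).Loc) (γ : ℝ) (p : XSK κ i) :
    |evSK (κ := κ) i lam p| ≤ (geo9K i).len (blkSK i sI p) ^ γ * (geo9K i).wNorm γ lam := by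
  rw [len_blkSK_eq i hlevS]
  cases lam with
  | inr J =>
      show |(0 : ℝ)| ≤ _
      rw [abs_zero]
      exact mul_nonneg (Real.rpow_nonneg (lenSZ_pos i p.1).le _) (geo9K_wNorm_nonneg i γ _)
  | inl f =>
      refine (abs_evDiagK_le f p).trans ?_
      have h := abs_le_wNormS_mul_scale i γ f p.1
      rw [mul_comm] at h
      exact h

/-- ★★ **`GlobReads (kernelFamilyS …) 0 U₁ (blkSK sI) (blkSK sI) evSK (GcoS …)`** for EVERY site-sector letter and EVERY `U₁` (n06-k's (3.47) species; `sI`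
level-faithful): `|η²O(U)(f ⊗ E)|_{(2+γ)} ≤ C` from the coordinate bound `C·(Lʲη)^{2+γ}`. [cite: Balaban1985BackgroundPropagators, (3.41) p.397 + (3.47) p.398; Balaban1984PropagatorsII, (2.67) p.234] -/
theorem globReads_kernelFamilyS_coords_zero (hlevS : ∀ z : SiteY i, lvl i.hN i.D i.hk (sI z) = (blkOf i.D.toDomains z).1.1) :
    GlobReads (kernelFamilyS i B cfg O par) 0 U₁ (blkSK i sI) (blkSK i sI) (evSK i) (GcoS i b B cfg O U₁) := by
  refine ⟨fun lam γ p => evSK_wbound i hlevS lam γ p, fun lam γ => geo9K_wNorm_nonneg i γ lam, ?_⟩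
  intro lam γ C hC hx
  cases lam with
  | inr J => exact hC
  | inl f =>
      have hη : 0 < etaS i ^ 2 := pow_pos (etaS_pos i) 2
      show (⨆ E : BallY 𝔸, ((![wNormSY i (2 + γ) (fun z => ((etaS i ^ 2 : ℝ) : ℂ) • O (cfg U₁) (liftY f (E : 𝔸)) z),
          ⨆ μ : Fin (d + 1), wNormSY i (1 + γ) (fun z => ((etaS i : ℝ) : ℂ) • cdS i (cfg U₁) μ (O (cfg U₁) (liftY f (E : 𝔸))) z),
          ⨆ μ : Fin (d + 1), wNormSY i (1 + γ) (fun z => ((etaS i : ℝ) : ℂ) • O (cfg U₁) (cdsS i (cfg U₁) μ (liftY f (E : 𝔸))) z),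
          wNormSY i γ (lapS i (cfg U₁) (O (cfg U₁) (liftY f (E : 𝔸))))] : Fin 4 → ℝ) 0)) ≤ C
      refine iSup_ball_le (fun E => ?_) hC
      show wNormSY i (2 + γ) (fun z => ((etaS i ^ 2 : ℝ) : ℂ) • O (cfg U₁) (liftY f (E : 𝔸)) z) ≤ C
      refine wNormSY_le_of_pointwise i hC fun z => ?_
      have hco : ∀ (ν : Fin (d + 1)) (cc cc' : κ), |((etaS i ^ 2 * cR39 b) • coordOpK b (fun _ : Fin (d + 1) => (O (cfg U₁)).restrictScalars ℝ)) (evDiagK f) (z, ν, cc, cc')|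
          ≤ C * lenSZ i z ^ ((2 : ℝ) + γ) := fun ν cc cc' => by
        have h := hx (z, ν, cc, cc'); rw [len_blkSK_eq i hlevS] at h; simp only [Matrix.cons_val_zero] at h; exact h
      rw [norm_smul, Complex.norm_real, Real.norm_of_nonneg hη.le]
      exact mul_norm_le_of_coordModelK_le_at b (fun _ : Fin (d + 1) => (O (cfg U₁)).restrictScalars ℝ) f z
        (mul_nonneg hC (Real.rpow_nonneg (lenSZ_pos i z).le _)) hη hco (mem_closedBall_zero_iff.1 E.2) 0

/-- ★★ **`GlobReads … 1 U₁ (blkSK sI) (blkSK sI) evSK (DcoS ∘ₗ GcoS)`**: `sup_μ |η∇_{U,μ}O(U)(f ⊗ E)|_{(1+γ)} ≤ C`. [cite: Balaban1985BackgroundPropagators, (3.41) p.397 + (3.47) p.398] -/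
theorem globReads_kernelFamilyS_coords_one (hlevS : ∀ z : SiteY i, lvl i.hN i.D i.hk (sI z) = (blkOf i.D.toDomains z).1.1) :
    GlobReads (kernelFamilyS i B cfg O par) 1 U₁ (blkSK i sI) (blkSK i sI) (evSK i) (DcoS i b B cfg U₁ ∘ₗ GcoS i b B cfg O U₁) := by
  refine ⟨fun lam γ p => evSK_wbound i hlevS lam γ p, fun lam γ => geo9K_wNorm_nonneg i γ lam, ?_⟩
  intro lam γ C hC hx
  cases lam with
  | inr J => exact hC
  | inl f =>
      have hη : 0 < etaS i := etaS_pos i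
      rw [DcoS_comp_GcoS] at hx
      show (⨆ E : BallY 𝔸, ((![wNormSY i (2 + γ) (fun z => ((etaS i ^ 2 : ℝ) : ℂ) • O (cfg U₁) (liftY f (E : 𝔸)) z),
          ⨆ μ : Fin (d + 1), wNormSY i (1 + γ) (fun z => ((etaS i : ℝ) : ℂ) • cdS i (cfg U₁) μ (O (cfg U₁) (liftY f (E : 𝔸))) z),
          ⨆ μ : Fin (d + 1), wNormSY i (1 + γ) (fun z => ((etaS i : ℝ) : ℂ) • O (cfg U₁) (cdsS i (cfg U₁) μ (liftY f (E : 𝔸))) z),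
          wNormSY i γ (lapS i (cfg U₁) (O (cfg U₁) (liftY f (E : 𝔸))))] : Fin 4 → ℝ) 1)) ≤ C
      refine iSup_ball_le (fun E => ?_) hC
      show (⨆ μ : Fin (d + 1), wNormSY i (1 + γ) (fun z => ((etaS i : ℝ) : ℂ) • cdS i (cfg U₁) μ (O (cfg U₁) (liftY f (E : 𝔸))) z)) ≤ C
      refine Real.iSup_le (fun μ => wNormSY_le_of_pointwise i hC fun z => ?_) hC
      have hco : ∀ (ν : Fin (d + 1)) (cc cc' : κ), |((etaS i * cR39 b) • coordOpK b (fun ν => (cdSL i (cfg U₁) ν).restrictScalars ℝ ∘ₗ (O (cfg U₁)).restrictScalars ℝ))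
          (evDiagK f) (z, ν, cc, cc')| ≤ C * lenSZ i z ^ ((1 : ℝ) + γ) := fun ν cc cc' => by
        have h := hx (z, ν, cc, cc'); rw [len_blkSK_eq i hlevS] at h; simp only [Matrix.cons_val_one, Matrix.cons_val_zero] at h; exact h
      rw [norm_smul, Complex.norm_real, Real.norm_of_nonneg hη.le]
      exact mul_norm_le_of_coordModelK_le_at b (fun ν => (cdSL i (cfg U₁) ν).restrictScalars ℝ ∘ₗ (O (cfg U₁)).restrictScalars ℝ) f z
        (mul_nonneg hC (Real.rpow_nonneg (lenSZ_pos i z).le _)) hη hco (mem_closedBall_zero_iff.1 E.2) μ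

/-- ★★ **`GlobReads … 2 U₁ (blkSK sI) (blkSK sI) evSK (GcoS ∘ₗ DscoS)`**: `sup_μ |ηO(U)∇*_{U,μ}(f ⊗ E)|_{(1+γ)} ≤ C`. [cite: Balaban1985BackgroundPropagators, (3.41) p.397 + (3.47) p.398] -/
theorem globReads_kernelFamilyS_coords_two (hlevS : ∀ z : SiteY i, lvl i.hN i.D i.hk (sI z) = (blkOf i.D.toDomains z).1.1) :
    GlobReads (kernelFamilyS i B cfg O par) 2 U₁ (blkSK i sI) (blkSK i sI) (evSK i) (GcoS i b B cfg O U₁ ∘ₗ DscoS i b B cfg U₁) := by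
  refine ⟨fun lam γ p => evSK_wbound i hlevS lam γ p, fun lam γ => geo9K_wNorm_nonneg i γ lam, ?_⟩
  intro lam γ C hC hx
  cases lam with
  | inr J => exact hC
  | inl f =>
      have hη : 0 < etaS i := etaS_pos i
      rw [GcoS_comp_DscoS] at hx
      show (⨆ E : BallY 𝔸, ((![wNormSY i (2 + γ) (fun z => ((etaS i ^ 2 : ℝ) : ℂ) • O (cfg U₁) (liftY f (E : 𝔸)) z),
          ⨆ μ : Fin (d + 1), wNormSY i (1 + γ) (fun z => ((etaS i : ℝ) : ℂ) • cdS i (cfg U₁) μ (O (cfg U₁) (liftY f (E : 𝔸))) z),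
          ⨆ μ : Fin (d + 1), wNormSY i (1 + γ) (fun z => ((etaS i : ℝ) : ℂ) • O (cfg U₁) (cdsS i (cfg U₁) μ (liftY f (E : 𝔸))) z),
          wNormSY i γ (lapS i (cfg U₁) (O (cfg U₁) (liftY f (E : 𝔸))))] : Fin 4 → ℝ) 2)) ≤ C
      refine iSup_ball_le (fun E => ?_) hC
      show (⨆ μ : Fin (d + 1), wNormSY i (1 + γ) (fun z => ((etaS i : ℝ) : ℂ) • O (cfg U₁) (cdsS i (cfg U₁) μ (liftY f (E : 𝔸))) z)) ≤ C
      refine Real.iSup_le (fun μ => wNormSY_le_of_pointwise i hC fun z => ?_) hC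
      have hco : ∀ (ν : Fin (d + 1)) (cc cc' : κ), |((etaS i * cR39 b) • coordOpK b (fun ν => (O (cfg U₁)).restrictScalars ℝ ∘ₗ (cdsSL i (cfg U₁) ν).restrictScalars ℝ))
          (evDiagK f) (z, ν, cc, cc')| ≤ C * lenSZ i z ^ ((1 : ℝ) + γ) := fun ν cc cc' => by
        have h := hx (z, ν, cc, cc'); rw [len_blkSK_eq i hlevS] at h; simp only [Matrix.cons_val_two, Matrix.tail_cons, Matrix.head_cons] at h; exact h
      rw [norm_smul, Complex.norm_real, Real.norm_of_nonneg hη.le]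
      exact mul_norm_le_of_coordModelK_le_at b (fun ν => (O (cfg U₁)).restrictScalars ℝ ∘ₗ (cdsSL i (cfg U₁) ν).restrictScalars ℝ) f z
        (mul_nonneg hC (Real.rpow_nonneg (lenSZ_pos i z).le _)) hη hco (mem_closedBall_zero_iff.1 E.2) μ

/-- ★★ **`GlobReads … 3 U₁ (blkSK sI) (blkSK sI) evSK (LcoS ∘ₗ GcoS)`**: `|Δ_U O(U)(f ⊗ E)|_{(γ)} ≤ C`. [cite: Balaban1985BackgroundPropagators, (3.41) p.397 + (3.47) p.398] -/
theorem globReads_kernelFamilyS_coords_three (hlevS : ∀ z : SiteY i, lvl i.hN i.D i.hk (sI z) = (blkOf i.D.toDomains z).1.1) :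
    GlobReads (kernelFamilyS i B cfg O par) 3 U₁ (blkSK i sI) (blkSK i sI) (evSK i) (LcoS i b B cfg U₁ ∘ₗ GcoS i b B cfg O U₁) := by
  refine ⟨fun lam γ p => evSK_wbound i hlevS lam γ p, fun lam γ => geo9K_wNorm_nonneg i γ lam, ?_⟩
  intro lam γ C hC hx
  cases lam with
  | inr J => exact hC
  | inl f =>
      rw [LcoS_comp_GcoS] at hx
      show (⨆ E : BallY 𝔸, ((![wNormSY i (2 + γ) (fun z => ((etaS i ^ 2 : ℝ) : ℂ) • O (cfg U₁) (liftY f (E : 𝔸)) z),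
          ⨆ μ : Fin (d + 1), wNormSY i (1 + γ) (fun z => ((etaS i : ℝ) : ℂ) • cdS i (cfg U₁) μ (O (cfg U₁) (liftY f (E : 𝔸))) z),
          ⨆ μ : Fin (d + 1), wNormSY i (1 + γ) (fun z => ((etaS i : ℝ) : ℂ) • O (cfg U₁) (cdsS i (cfg U₁) μ (liftY f (E : 𝔸))) z),
          wNormSY i γ (lapS i (cfg U₁) (O (cfg U₁) (liftY f (E : 𝔸))))] : Fin 4 → ℝ) 3)) ≤ C
      refine iSup_ball_le (fun E => ?_) hC
      show wNormSY i γ (lapS i (cfg U₁) (O (cfg U₁) (liftY f (E : 𝔸)))) ≤ C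
      refine wNormSY_le_of_pointwise i hC fun z => ?_
      have hco : ∀ (ν : Fin (d + 1)) (cc cc' : κ), |(cR39 b • coordOpK b (fun _ : Fin (d + 1) => lapSₗ i (cfg U₁) ∘ₗ (O (cfg U₁)).restrictScalars ℝ)) (evDiagK f) (z, ν, cc, cc')|
          ≤ C * lenSZ i z ^ γ := fun ν cc cc' => by
        have h := hx (z, ν, cc, cc'); rw [len_blkSK_eq i hlevS] at h; simp only [Matrix.cons_val_three, Matrix.tail_cons, Matrix.head_cons, zero_add] at h; exact h
      have h : ‖(lapSₗ i (cfg U₁) ∘ₗ (O (cfg U₁)).restrictScalars ℝ) (liftY f (E : 𝔸)) z‖ ≤ C * lenSZ i z ^ γ :=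
        norm_le_of_coordModelK_le_at b (fun _ : Fin (d + 1) => lapSₗ i (cfg U₁) ∘ₗ (O (cfg U₁)).restrictScalars ℝ) f z
          (mul_nonneg hC (Real.rpow_nonneg (lenSZ_pos i z).le _)) hco (mem_closedBall_zero_iff.1 E.2) 0
      rw [LinearMap.comp_apply, lapSₗ_apply] at h
      exact h

end CoReading

end Literature.MathematicalPhysics.QuantumFieldTheory.Balaban1983to89.B9CoReadingCoordsS

end
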